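import Summits.Ventures.CertifiedManyBodySolver.Downfold.EmeryFermiScaleFaceCCertE
import Summits.Ventures.CertifiedManyBodySolver.Downfold.EmeryFermiScaleFaceLever
import HarnessLib

/-!
# THE ANTINODAL SCALE LEVER FOR GENERAL `t_pp′`: on the face window, under `t_ppΔ < 4t_pd²` and `t_pp ≤ |t_pd|`, the velocity-matched one-band `t` at the zone-face Fermi point of
# the σ three-band model, `t_face(ε) = scaleT(1, yFace(ε); ε)`, is strictly DECREASING in the Fermi energy — hole doping RAISES the antinodal `t` (with the nodal lever: BOTH ends)

Venture CertifiedManyBodySolver, cell `pub/hubbard-downfold` (stage S1; INFLATION-RULES-3to1-B §B.74 (b″)), seat hubbard-downfold-mod-4 (technique B, g30); namespace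
`Summit.Ventures.CertifiedManyBodySolver.Downfold.Emery`. Sequel of `EmeryFermiScaleFace` (`scaleT_face_eq`), `EmeryFermiScaleFaceLever` (the `t_pp′ = 0` case, g29) and
`EmeryFermiScaleFaceCCertA/B/C/D/E` (`scaleFaceCCert`, `scaleFaceCCert_pos`: a 2016-term integer-weight Handelman-form certificate in the variables `(Δ, ε₁, d = ε₂ − ε₁, t_pp′, h = t_pp − t_pp′,
m = t_pd² − t_pp′ε₂)` and the atoms `Q = 4t_pd² − t_ppΔ`, `G₁ = faceG(ε₁)`, `G₂ = (8fsD + 16fsN − cA)(ε₂)`, `P = t_pd² − t_pp²`, found by linear programming — kit jobs of this seat — and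
re-checked here by `ring`). Everything PROVED (0 sorry). WHAT THIS IS NOT: a statement about any material; `U = 0` one-body kinematics of the σ model as printed; the hypothesis
`t_pp ≤ |t_pd|` is a SUFFICIENT regime located by the certificate search (every typed cuprate row has `t_pp/t_pd ≈ 0.5`); without it no Handelman certificate of degree ≤ 4 exists in the
natural atoms (kit j339562, j339606: the obstruction sits at the un-physical corner `t_pp ≫ Δ, ε, t_pd`).

* §1 `scaleFaceC_cross_eq`: `L·(scaleFaceN(ε₁)scaleFaceD(ε₂) − scaleFaceN(ε₂)scaleFaceD(ε₁)) = (ε₂ − ε₁)·scaleFaceCCert(…)` with `t_pp = c + h` (`ring`), `L = 1000000`.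
* §2 **`scaleT_face_strictAnti`**: `Δ > 0`, `0 ≤ t_pp′ ≤ t_pp`, `t_pp² ≤ t_pd²`, `t_pd ≠ 0`, `0 < ε₁ < ε₂`, `t_pp′ε₂ < t_pd²`, `faceG(ε₁) ≥ 0` (the `ε₁`-surface hole-like), the `ε₂`-surface in
  the zone, `t_ppΔ < 4t_pd²` ⇒ `t_face(ε₂) < t_face(ε₁)`. Bracket rule `scaleFaceLeverCheckC` (rational inputs) with `scaleT_face_strictAnti_of_checkC` and `scaleFaceLeverC_of_brackets`.
* READING (with `EmeryFermiScaleHarmonic`): `1/t_face = (α + 8β(1 − yFace))/fsT²`; the lever is the sum of the convexity of the Γ offset `cA/fsT` and a shape term whose sign is that of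
  `−β = −fsT²·d|t′/t|/dε`; the certificate covers both signs of `β` inside the regime.

Sources: three-band model [HybertsenSchluterChristensen1989, Eq. (1)]; [AndersenEtAl1995, §6]; Handelman certificates [folklore] (Handelman, Pacific J. Math. 132 (1988)).
-/

noncomputable section

namespace Summit.Ventures.CertifiedManyBodySolver.Downfold.Emery

open Real Set

/-! ## §1 The certificate identity (general t_pp′) -/

set_option maxRecDepth 16384 in
/-- **THE CERTIFICATE IDENTITY** (`t_pp = c + h`, `ε₂ = ε₁ + d`, `m = t_pd² − c·ε₂` substituted; scaled by `L = 1000000`). [folklore] -/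
theorem scaleFaceC_cross_eq (Δ tpd c h ε₁ d : ℝ) :
    (1000000 : ℝ) * (scaleFaceN Δ tpd (c + h) c ε₁ * scaleFaceD Δ tpd (c + h) c (ε₁ + d) - scaleFaceN Δ tpd (c + h) c (ε₁ + d) * scaleFaceD Δ tpd (c + h) c ε₁) =
      d * scaleFaceCCert Δ ε₁ d c h (tpd ^ 2 - c * (ε₁ + d)) (4 * tpd ^ 2 - (c + h) * Δ) (ε₁ * (Δ + ε₁) + 4 * c * ε₁ - 4 * tpd ^ 2)
        (8 * (Δ + (ε₁ + d)) * (tpd ^ 2 - c * (ε₁ + d)) + 16 * (2 * c + h) * (2 * tpd ^ 2 + h * (ε₁ + d)) - (ε₁ + d) * (Δ + (ε₁ + d)) ^ 2) (tpd ^ 2 - (c + h) ^ 2) := by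
  unfold scaleFaceN scaleFaceD fsT fsD faceN faceR fsN scaleFaceCCert scaleFaceCCertP1 scaleFaceCCertP2 scaleFaceCCertP3 scaleFaceCCertP4 scaleFaceCCertP5 scaleFaceCCertP6 scaleFaceCCertP7 scaleFaceCCertP8 scaleFaceCCertP9 scaleFaceCCertP10 scaleFaceCCertP11 scaleFaceCCertP12 scaleFaceCCertP13 scaleFaceCCertP14 scaleFaceCCertP15 scaleFaceCCertP16 scaleFaceCCertP17 scaleFaceCCertP18 scaleFaceCCertP19 scaleFaceCCertP20 scaleFaceCCertP21 scaleFaceCCertP22 scaleFaceCCertP23 scaleFaceCCertP24 scaleFaceCCertP25 scaleFaceCCertP26 scaleFaceCCertP27 scaleFaceCCertP28 scaleFaceCCertP29 scaleFaceCCertP30 scaleFaceCCertP31 scaleFaceCCertP32 scaleFaceCCertP33 scaleFaceCCertP34 scaleFaceCCertP35 scaleFaceCCertP36 scaleFaceCCertP37 scaleFaceCCertP38 scaleFaceCCertP39 scaleFaceCCertP40 scaleFaceCCertP41 scaleFaceCCertP42 scaleFaceCCertP43 scaleFaceCCertP44 scaleFaceCCertP45 scaleFaceCCertP46 scaleFaceCCertP47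 scaleFaceCCertP48 scaleFaceCCertP49 scaleFaceCCertP50 scaleFaceCCertP51 scaleFaceCCertP52 scaleFaceCCertP53 scaleFaceCCertP54 scaleFaceCCertP55 scaleFaceCCertP56 scaleFaceCCertP57 scaleFaceCCertP58 scaleFaceCCertP59 scaleFaceCCertP60 scaleFaceCCertP61 scaleFaceCCertP62 scaleFaceCCertP63 scaleFaceCCertP64 scaleFaceCCertP65 scaleFaceCCertP66 scaleFaceCCertP67 scaleFaceCCertP68 scaleFaceCCertP69 scaleFaceCCertP70 scaleFaceCCertP71 scaleFaceCCertP72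
  ring

/-! ## §2 The antinodal scale lever, general t_pp′ -/

/-- **THE ANTINODAL SCALE IS STRICTLY DECREASING IN THE FERMI ENERGY, GENERAL `t_pp′`** (`Δ > 0`, `0 ≤ t_pp′ ≤ t_pp`, `t_pp² ≤ t_pd²`, `t_pd ≠ 0`, `0 < ε₁ < ε₂`, `t_pp′ε₂ < t_pd²`,
`faceG(ε₁) ≥ 0`, `cA(ε₂) ≤ 8fsD(ε₂) + 16fsN(ε₂)`, `t_ppΔ < 4t_pd²`): `scaleT(1, yFace(ε₂); ε₂) < scaleT(1, yFace(ε₁); ε₁)` — hole doping RAISES the one-band `t` at the antinode. [folklore] -/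
theorem scaleT_face_strictAnti {Δ tpd tpp c ε₁ ε₂ : ℝ} (hΔ : 0 < Δ) (hc : 0 ≤ c) (hct : c ≤ tpp) (hp : tpp ^ 2 ≤ tpd ^ 2) (htpd : tpd ≠ 0) (h1 : 0 < ε₁) (h12 : ε₁ < ε₂)
    (hm : c * ε₂ < tpd ^ 2) (hlo : 0 ≤ faceG Δ tpd c ε₁) (hhi : cA Δ ε₂ ≤ 8 * fsD Δ tpd c ε₂ + 16 * fsN tpd tpp c ε₂) (hq : tpp * Δ < 4 * tpd ^ 2) :
    scaleT Δ tpd tpp c 1 (yFace Δ tpd tpp c ε₂) ε₂ < scaleT Δ tpd tpp c 1 (yFace Δ tpd tpp c ε₁) ε₁ := by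
  have h2 : 0 < ε₂ := h1.trans h12
  have ht : 0 < tpd ^ 2 := by positivity
  have hm1 : c * ε₁ < tpd ^ 2 := lt_of_le_of_lt (mul_le_mul_of_nonneg_left h12.le hc) hm
  have hlo2 : 0 ≤ faceG Δ tpd c ε₂ := hlo.trans (faceG_mono hΔ.le hc h1.le h12.le)
  rw [scaleT_face_eq (by linarith) hc hct h2 hm hlo2, scaleT_face_eq (by linarith) hc hct h1 hm1 hlo,
    div_lt_div_iff₀ (scaleFaceD_pos (by linarith) hc hct h2 hm hlo2) (scaleFaceD_pos (by linarith) hc hct h1 hm1 hlo), ← sub_pos]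
  obtain ⟨d, rfl⟩ : ∃ d, ε₂ = ε₁ + d := ⟨ε₂ - ε₁, by ring⟩
  obtain ⟨h, rfl⟩ : ∃ h, tpp = c + h := ⟨tpp - c, by ring⟩
  have hd : 0 < d := by linarith
  have hh : 0 ≤ h := by linarith
  have hG₂ : 0 ≤ 8 * (Δ + (ε₁ + d)) * (tpd ^ 2 - c * (ε₁ + d)) + 16 * (2 * c + h) * (2 * tpd ^ 2 + h * (ε₁ + d)) - (ε₁ + d) * (Δ + (ε₁ + d)) ^ 2 := by
    have e := faceHi_eq Δ tpd (c + h) c (ε₁ + d)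
    have e2 : 8 * (Δ + (ε₁ + d)) * (tpd ^ 2 - c * (ε₁ + d)) + 16 * (c + (c + h - c) + c) * (2 * tpd ^ 2 + (c + h - c) * (ε₁ + d)) - (ε₁ + d) * (Δ + (ε₁ + d)) ^ 2 =
        8 * (Δ + (ε₁ + d)) * (tpd ^ 2 - c * (ε₁ + d)) + 16 * (2 * c + h) * (2 * tpd ^ 2 + h * (ε₁ + d)) - (ε₁ + d) * (Δ + (ε₁ + d)) ^ 2 := by ring
    linarith
  have hG₁ : 0 ≤ ε₁ * (Δ + ε₁) + 4 * c * ε₁ - 4 * tpd ^ 2 := by unfold faceG at hlo; linarith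
  have hQ : 0 ≤ 4 * tpd ^ 2 - (c + h) * Δ := by linarith
  have hP : 0 ≤ tpd ^ 2 - (c + h) ^ 2 := by linarith
  have hM : 0 < tpd ^ 2 - c * (ε₁ + d) := by linarith
  have key := scaleFaceC_cross_eq Δ tpd c h ε₁ d
  have hC := scaleFaceCCert_pos (Δ := Δ) (ε₁ := ε₁) (d := d) (c := c) (h := h) (m := tpd ^ 2 - c * (ε₁ + d)) (Q := 4 * tpd ^ 2 - (c + h) * Δ)
    (G₁ := ε₁ * (Δ + ε₁) + 4 * c * ε₁ - 4 * tpd ^ 2)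
    (G₂ := 8 * (Δ + (ε₁ + d)) * (tpd ^ 2 - c * (ε₁ + d)) + 16 * (2 * c + h) * (2 * tpd ^ 2 + h * (ε₁ + d)) - (ε₁ + d) * (Δ + (ε₁ + d)) ^ 2) (P := tpd ^ 2 - (c + h) ^ 2)
    hΔ h1 hd hc hh hM hQ hG₁ hG₂ hP
  have hL : (0 : ℝ) < 1000000 := by norm_num
  have hX : 0 < scaleFaceN Δ tpd (c + h) c ε₁ * scaleFaceD Δ tpd (c + h) c (ε₁ + d) - scaleFaceN Δ tpd (c + h) c (ε₁ + d) * scaleFaceD Δ tpd (c + h) c ε₁ := by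
    have : 0 < (1000000 : ℝ) * (scaleFaceN Δ tpd (c + h) c ε₁ * scaleFaceD Δ tpd (c + h) c (ε₁ + d) - scaleFaceN Δ tpd (c + h) c (ε₁ + d) * scaleFaceD Δ tpd (c + h) c ε₁) := by
      rw [key]; exact mul_pos hd hC
    exact pos_of_mul_pos_right this hL.le
  linarith

/-- **`scaleFaceLeverCheckC`** (general `t_pp′`): a σ point `(Δ, a, b, c) = (Δ_pd, t_pd, t_pp, t_pp′) ∈ ℚ⁴`, the bottom `e₁` of the LOWER ε_F bracket and the top `e₂` of the HIGHER one; tests: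
regime (`Δ > 0`, `0 ≤ c ≤ b`, `b² ≤ a²`, `a ≠ 0`, `bΔ < 4a²`), `e₁ > 0`, lower face-window edge at `e₁`, upper edge at `e₂`, `c·e₂ < a²`. [folklore] -/
def scaleFaceLeverCheckC (Δ a b c e₁ e₂ : ℚ) : Bool :=
  decide (0 < Δ) && decide (0 ≤ c) && decide (c ≤ b) && decide (b ^ 2 ≤ a ^ 2) && decide (a ≠ 0) && decide (0 < e₁) &&
  decide (0 ≤ e₁ * (Δ + e₁) + 4 * c * e₁ - 4 * a ^ 2) &&
  decide (e₂ * (Δ + e₂) ^ 2 ≤ 8 * ((Δ + e₂) * (a ^ 2 - c * e₂)) + 16 * (2 * a ^ 2 * (c + b) + e₂ * (b ^ 2 - c ^ 2))) && decide (c * e₂ < a ^ 2) && decide (b * Δ < 4 * a ^ 2)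

/-- **SOUNDNESS of `scaleFaceLeverCheckC`**: for all real `e₁ ≤ ε₁ < ε₂ ≤ e₂`, `t_face(ε₂) < t_face(ε₁)` at the σ point `(Δ, a, b, c)`. [folklore] -/
theorem scaleT_face_strictAnti_of_checkC {Δ a b c e₁ e₂ : ℚ} (hck : scaleFaceLeverCheckC Δ a b c e₁ e₂ = true) {ε₁ ε₂ : ℝ} (h1 : (e₁ : ℝ) ≤ ε₁) (h12 : ε₁ < ε₂) (h2 : ε₂ ≤ (e₂ : ℝ)) :
    scaleT (Δ : ℝ) a b c 1 (yFace (Δ : ℝ) a b c ε₂) ε₂ < scaleT (Δ : ℝ) a b c 1 (yFace (Δ : ℝ) a b c ε₁) ε₁ := by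
  simp only [scaleFaceLeverCheckC, Bool.and_eq_true, decide_eq_true_eq] at hck
  obtain ⟨⟨⟨⟨⟨⟨⟨⟨⟨hΔ, hc⟩, hcb⟩, hp⟩, ha⟩, he⟩, hlo⟩, hhi⟩, hm⟩, hq⟩ := hck
  have hΔ' : (0 : ℝ) < Δ := by exact_mod_cast hΔ
  have hc' : (0 : ℝ) ≤ c := by exact_mod_cast hc
  have hcb' : (c : ℝ) ≤ b := by exact_mod_cast hcb
  have hε₁ : 0 < ε₁ := lt_of_lt_of_le (by exact_mod_cast he) h1
  have hlo' : 0 ≤ faceG (Δ : ℝ) a c ε₁ := by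
    have h0 : 0 ≤ faceG (Δ : ℝ) a c e₁ := by unfold faceG; exact_mod_cast (by nlinarith [hlo] : (0:ℚ) ≤ e₁ * (Δ + e₁) + 4 * c * e₁ - 4 * a ^ 2)
    exact h0.trans (faceG_mono hΔ'.le hc' (by exact_mod_cast he.le) h1)
  have hhi' : cA (Δ : ℝ) ε₂ ≤ 8 * fsD (Δ : ℝ) a c ε₂ + 16 * fsN (a : ℝ) b c ε₂ := by
    have h0 : cA (Δ : ℝ) e₂ ≤ 8 * fsD (Δ : ℝ) a c e₂ + 16 * fsN (a : ℝ) b c e₂ := by unfold cA fsD fsN; exact_mod_cast hhi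
    exact faceHi_anti hΔ'.le hc' (by linarith) (hε₁.trans h12) h2 h0
  have hm' : (c : ℝ) * ε₂ < (a : ℝ) ^ 2 := by
    have : (c : ℝ) * ε₂ ≤ (c : ℝ) * e₂ := mul_le_mul_of_nonneg_left h2 hc'
    exact lt_of_le_of_lt this (by exact_mod_cast hm)
  exact scaleT_face_strictAnti hΔ' hc' hcb' (by exact_mod_cast hp) (by exact_mod_cast ha) hε₁ h12 hm' hlo' hhi' (by exact_mod_cast hq)

/-- **THE ANTINODAL SCALE LEVER FROM BRACKETS** (general `t_pp′`): `scaleFaceLeverCheckC Δ a b c e₁ f₂`, `e₂ < f₁`, `ε₁ ∈ [e₁, e₂]`, `ε₂ ∈ [f₁, f₂]` ⇒ `ε₁ < ε₂ ∧ t_face(ε₂) < t_face(ε₁)`. [folklore] -/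
theorem scaleFaceLeverC_of_brackets {Δ a b c e₁ e₂ f₁ f₂ : ℚ} (hck : scaleFaceLeverCheckC Δ a b c e₁ f₂ = true) (hgap : e₂ < f₁) {ε₁ ε₂ : ℝ}
    (h1 : ε₁ ∈ Set.Icc (e₁ : ℝ) e₂) (h2 : ε₂ ∈ Set.Icc (f₁ : ℝ) f₂) :
    ε₁ < ε₂ ∧ scaleT (Δ : ℝ) a b c 1 (yFace (Δ : ℝ) a b c ε₂) ε₂ < scaleT (Δ : ℝ) a b c 1 (yFace (Δ : ℝ) a b c ε₁) ε₁ := by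
  have hgap' : (e₂ : ℝ) < f₁ := by exact_mod_cast hgap
  have h12 : ε₁ < ε₂ := lt_of_le_of_lt h1.2 (lt_of_lt_of_le hgap' h2.1)
  exact ⟨h12, scaleT_face_strictAnti_of_checkC hck h1.1 h12 h2.2⟩

end Summit.Ventures.CertifiedManyBodySolver.Downfold.Emery
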